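import Literature.Claims.NS.Nguyen2022

/-!
# C75 `Nguyen2022` — kernel refutation of THEOREM 3.0.1 (p. 17) AS PRINTED, at the field level

Text of record: arXiv:2004.08239 **v8**, typed skeleton `Literature.Claims.NS.Nguyen2022` (typist-9,
p467749; bib `Nguyen2022NSGlobalNoForce`).  Theorem 3.0.1 (p. 17, LOAD-BEARING for §4 via Cor 3.0.2)
asserts, for EVERY open connected `Ω`, horizon `T`, constants `C₀, C₁ > 0` and EVERY field `u` on
`Ω × [0,T)` whose energy `E(t) = ‖u(t)‖²_{L²(Ω)}` and enstrophy `Z(t) = ‖∇u(t)‖²_{L²(Ω)}` obey (3.0.1)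
`E′ = −C₀ Z`, `Z′ ≤ C₁ Z³` on `[0,T)`, that `E + Z` is non-increasing on `[0,T)` ((3.0.2)).  The skeleton
types it as `Step5_Theorem301` over `Laws301` / `Monotone302` (`energyOn`, `enstrophyOn` = the `ℝ≥0∞`-valued
`∫_Ω ‖u‖²`, `∫_Ω |∇u|²` with the Frobenius norm).

Companion file `SoloRefuteNguyen2022.lean` (salvage-p4, p470930) refutes the printed MECHANISM (`Step3_LambdaLimit`,
the «λ → 0» passage p. 19) and the scalar shadow `Step5_Theorem301_scalar`.  THIS file refutes the theorem
itself, as printed, with an explicit field: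

* `Ω = ℝ³`, `T = 1/2`, `C₀ = 1`, `C₁ = 2/e²`, `u(t,x) = a(t)·w(c(t)x)` with the smooth compactly supported
  profile `w = χ·e₀` (`χ` a `ContDiffBump`, `≡ 1` on the unit ball), `e = ‖w‖₂² ∈ (0,∞)`,
  `c(t)² = e(1+2t)/(‖∇w‖₂²(1 − t − t²))`, `a(t)² = (1 − t − t²)c(t)³`;
* the scaling laws `‖a·w(c·)‖₂² = a²c⁻³‖w‖₂²`, `‖∇(a·w(c·))‖₂² = a²c⁻¹‖∇w‖₂²` (`lintegral` change of
  variables `x ↦ c·x`, chain rule) give `E(t) = e(1 − t − t²)`, `Z(t) = e(1 + 2t)` on `[0, 1/2]`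
  (`energy_uu`, `enstrophy_uu`), hence (3.0.1) with `E′ = −Z`, `Z′ = 2e ≤ C₁Z³` (`laws_uu`);
* but `E + Z = e(2 + t − t²)` is larger at `t = 1/4` than at `t = 0` (`not_monotone_uu`).

`not_Step5_Theorem301 : ¬ Literature.Claims.NS.Nguyen2022.Step5_Theorem301`.  Both relations (3.0.1) are
invariant under the paper's own rescaling (3.0.3) — the countermodel is that rescaling run in time.  Closed
computation over Mathlib; axioms `propext`, `Classical.choice`, `Quot.sound`.  Refuter: ns-claims-refuter-5;
filed under interim convention (b) by the paired salvage prover.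

WHAT THIS IS NOT: not a claim about NS regularity or blow-up; not a claim about any author beyond the typed
locator.
-/

-- The summit's canonical theorem namespace repeats the summit name (single-conjunct summit).
set_option linter.dupNamespace false

noncomputable section

open Set Filter Topology MeasureTheory Metric
open scoped ENNReal
open Literature.Claims.NS.Nguyen2022 Literature.Analysis.FluidPDE

namespace Summit.NavierStokesRegularity.NavierStokesRegularity.Theorems.Nguyen2022

local notation "E3" => EuclideanSpace ℝ (Fin 3)

/-! ## Theorem 3.0.1 as printed: an explicit field on `ℝ³ × [0, 1/2)` -/

/-- A smooth bump: `≡ 1` on the unit ball, supported in the ball of radius 2. [folklore] -/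
def χ : ContDiffBump (0 : E3) := ⟨1, 2, one_pos, one_lt_two⟩

/-- The direction `e₀`. [folklore] -/
def v₀ : E3 := EuclideanSpace.single 0 1

/-- The profile field `w = χ · e₀`. [cite: Nguyen2022NSGlobalNoForce, Thm 3.0.1 p. 17] -/
def w (x : E3) : E3 := χ x • v₀

/-- `w` is smooth. [folklore] -/
theorem w_contDiff : ContDiff ℝ ((⊤ : ℕ∞) : WithTop ℕ∞) w := χ.contDiff.smul contDiff_const

/-- `w` is compactly supported. [folklore] -/
theorem w_hasCompactSupport : HasCompactSupport w := χ.hasCompactSupport.smul_right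

/-- `w` is differentiable. [folklore] -/
theorem w_differentiable : Differentiable ℝ w :=
  w_contDiff.differentiable (WithTop.coe_ne_zero.2 ENat.top_ne_zero)

/-- `e₀ ≠ 0`. [folklore] -/
theorem v₀_ne_zero : v₀ ≠ 0 := by
  rw [ne_eq, ← norm_eq_zero]
  simp [v₀]

/-- `w = e₀` on the unit ball. [folklore] -/
theorem w_eq_of_mem_ball {x : E3} (hx : x ∈ ball (0 : E3) 1) : w x = v₀ := by
  have h1 : χ x = 1 := χ.one_of_mem_closedBall (ball_subset_closedBall hx)
  simp [w, h1]

/-- `w` vanishes at `3e₀`. [folklore] -/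
theorem w_far : w (EuclideanSpace.single 0 (3 : ℝ)) = 0 := by
  have h0 : χ (EuclideanSpace.single 0 (3 : ℝ)) = 0 := by
    refine χ.zero_of_le_dist ?_
    rw [dist_zero_right]
    norm_num [χ]
  simp [w, h0]

/-- The energy `e = ‖w‖₂²` of the profile (in `ℝ≥0∞`). [cite: Nguyen2022NSGlobalNoForce, §2.1 p. 2] -/
def eW : ℝ≥0∞ := ∫⁻ x, ‖w x‖ₑ ^ 2

/-- The enstrophy `‖∇w‖₂²` of the profile (in `ℝ≥0∞`). [cite: Nguyen2022NSGlobalNoForce, §2.1 p. 2] -/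
def zW : ℝ≥0∞ := ∫⁻ x, ENNReal.ofReal (frobeniusNormSq (fderiv ℝ w x))

/-- `x ↦ |∇w(x)|²` is continuous. [folklore] -/
theorem continuous_frob_w : Continuous fun x => frobeniusNormSq (fderiv ℝ w x) := by
  have hc : Continuous (fderiv ℝ w) := w_contDiff.continuous_fderiv (by simp)
  unfold frobeniusNormSq
  exact continuous_finsetSum _ fun i _ => ((hc.clm_apply continuous_const).norm).pow 2

/-- `e < ∞`. [folklore] -/
theorem eW_lt_top : eW < ⊤ := by
  have hcs : HasCompactSupport ((fun v : E3 => ‖v‖ ^ 2) ∘ w) :=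
    w_hasCompactSupport.comp_left (by simp)
  have hint : Integrable (fun x => ‖w x‖ ^ 2) :=
    ((w_contDiff.continuous.norm).pow 2).integrable_of_hasCompactSupport hcs
  have h := hasFiniteIntegral_iff_enorm.1 hint.hasFiniteIntegral
  refine lt_of_eq_of_lt (lintegral_congr fun x => ?_) h
  rw [Real.enorm_eq_ofReal (sq_nonneg _), ENNReal.ofReal_pow (norm_nonneg _), ofReal_norm]

/-- `‖∇w‖₂² < ∞`. [folklore] -/
theorem zW_lt_top : zW < ⊤ := by
  have hcs : HasCompactSupport (frobeniusNormSq ∘ fderiv ℝ w) :=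
    (w_hasCompactSupport.fderiv (𝕜 := ℝ)).comp_left frobeniusNormSq_zero
  have hint : Integrable (fun x => frobeniusNormSq (fderiv ℝ w x)) :=
    continuous_frob_w.integrable_of_hasCompactSupport hcs
  have h := hasFiniteIntegral_iff_enorm.1 hint.hasFiniteIntegral
  refine lt_of_eq_of_lt (lintegral_congr fun x => ?_) h
  rw [Real.enorm_eq_ofReal (frobeniusNormSq_nonneg _)]

/-- `e > 0` (the unit ball contributes its volume). [folklore] -/
theorem eW_pos : 0 < eW := by
  have hball : 0 < volume (ball (0 : E3) 1) := measure_ball_pos volume 0 one_pos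
  refine hball.trans_le ?_
  calc volume (ball (0 : E3) 1) = ∫⁻ x in ball (0 : E3) 1, 1 := (setLIntegral_one _).symm
    _ = ∫⁻ x in ball (0 : E3) 1, ‖w x‖ₑ ^ 2 := by
        refine setLIntegral_congr_fun measurableSet_ball fun x hx => ?_
        rw [w_eq_of_mem_ball hx, ← ofReal_norm]
        simp [v₀]
    _ ≤ eW := setLIntegral_le_lintegral _ _

/-- A linear map with zero Frobenius norm is zero. [folklore] -/
theorem eq_zero_of_frobeniusNormSq_eq_zero {M : E3 →L[ℝ] E3} (h : frobeniusNormSq M = 0) :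
    M = 0 := by
  unfold frobeniusNormSq at h
  have h' := (Finset.sum_eq_zero_iff_of_nonneg fun i _ => sq_nonneg _).1 h
  have hb : ∀ i, M ((stdOrthonormalBasis ℝ E3) i) = 0 := fun i => by
    have := h' i (Finset.mem_univ i)
    rwa [sq_eq_zero_iff, norm_eq_zero] at this
  have hl : (M : E3 →ₗ[ℝ] E3) = ((0 : E3 →L[ℝ] E3) : E3 →ₗ[ℝ] E3) :=
    (stdOrthonormalBasis ℝ E3).toBasis.ext fun i => by simpa using hb i
  exact ContinuousLinearMap.coe_injective hl

/-- `‖∇w‖₂² > 0` (else `∇w ≡ 0` and `w` would be constant, but `w(0) = e₀ ≠ 0 = w(3e₀)`). [folklore] -/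
theorem zW_pos : 0 < zW := by
  rw [pos_iff_ne_zero]
  intro hz
  have hmeas : Measurable fun x => ENNReal.ofReal (frobeniusNormSq (fderiv ℝ w x)) :=
    continuous_frob_w.measurable.ennreal_ofReal
  have hae := (lintegral_eq_zero_iff hmeas).1 hz
  have hcont : Continuous fun x => ENNReal.ofReal (frobeniusNormSq (fderiv ℝ w x)) :=
    ENNReal.continuous_ofReal.comp continuous_frob_w
  have hzero := (Continuous.ae_eq_iff_eq volume hcont continuous_const).1 hae
  have hfd : ∀ x, fderiv ℝ w x = 0 := fun x => by
    have hx : ENNReal.ofReal (frobeniusNormSq (fderiv ℝ w x)) = 0 := by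
      simpa using congrFun hzero x
    exact eq_zero_of_frobeniusNormSq_eq_zero
      (le_antisymm (ENNReal.ofReal_eq_zero.1 hx) (frobeniusNormSq_nonneg _))
  have hc := is_const_of_fderiv_eq_zero w_differentiable hfd 0 (EuclideanSpace.single 0 (3 : ℝ))
  rw [w_far, w_eq_of_mem_ball (mem_ball_self one_pos)] at hc
  exact v₀_ne_zero hc

/-- The real energy `e` of the profile. [folklore] -/
def er : ℝ := eW.toReal

/-- The real enstrophy of the profile. [folklore] -/
def zr : ℝ := zW.toReal

/-- `e > 0`. [folklore] -/
theorem er_pos : 0 < er := ENNReal.toReal_pos eW_pos.ne' eW_lt_top.ne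

/-- `‖∇w‖₂² > 0` as a real. [folklore] -/
theorem zr_pos : 0 < zr := ENNReal.toReal_pos zW_pos.ne' zW_lt_top.ne

/-- `e` in `ℝ≥0∞`. [folklore] -/
theorem eW_eq : eW = ENNReal.ofReal er := (ENNReal.ofReal_toReal eW_lt_top.ne).symm

/-- `‖∇w‖₂²` in `ℝ≥0∞`. [folklore] -/
theorem zW_eq : zW = ENNReal.ofReal zr := (ENNReal.ofReal_toReal zW_lt_top.ne).symm

/-- Change of variables `x ↦ R·x` in `ℝ³` for the lower Lebesgue integral. [folklore] -/
theorem lintegral_comp_smul (f : E3 → ℝ≥0∞) {R : ℝ} (hR : R ≠ 0) :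
    ∫⁻ x, f (R • x) = ENNReal.ofReal |(R ^ 3)⁻¹| * ∫⁻ x, f x := by
  calc ∫⁻ x, f (R • x) = ∫⁻ y, f y ∂(Measure.map (fun x : E3 => R • x) volume) :=
        (lintegral_map_equiv f
          (Homeomorph.smul (isUnit_iff_ne_zero.2 hR).unit).toMeasurableEquiv).symm
    _ = ENNReal.ofReal |(R ^ 3)⁻¹| * ∫⁻ x, f x := by
        rw [Measure.map_addHaar_smul volume hR, lintegral_smul_measure, finrank_euclideanSpace_fin,
          smul_eq_mul]

/-- `|k·M|² = k²|M|²`. [folklore] -/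
theorem frobeniusNormSq_smul (k : ℝ) (M : E3 →L[ℝ] E3) :
    frobeniusNormSq (k • M) = k ^ 2 * frobeniusNormSq M := by
  simp [frobeniusNormSq, norm_smul, mul_pow, Finset.mul_sum, sq_abs]

/-- Chain rule for the rescaled, modulated profile. [folklore] -/
theorem hasFDerivAt_smul_w_smul (a c : ℝ) (x : E3) :
    HasFDerivAt (fun y : E3 => a • w (c • y)) ((a * c) • fderiv ℝ w (c • x)) x := by
  have hw : HasFDerivAt w (fderiv ℝ w (c • x)) (c • x) :=
    (w_differentiable (c • x)).hasFDerivAt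
  have hs : HasFDerivAt (fun y : E3 => c • y) (c • ContinuousLinearMap.id ℝ E3) x :=
    (hasFDerivAt_id x).const_smul c
  have h2 : HasFDerivAt (fun y : E3 => a • w (c • y))
      (a • (fderiv ℝ w (c • x)).comp (c • ContinuousLinearMap.id ℝ E3)) x :=
    (hw.comp x hs).const_smul a
  refine h2.congr_fderiv ?_
  ext v i
  simp [smul_smul]

/-! ### The time profile -/

/-- `h(t) = 1 − t − t²` (so `E = e·h`). [cite: Nguyen2022NSGlobalNoForce, Thm 3.0.1 p. 17] -/
def hh (t : ℝ) : ℝ := 1 - t - t ^ 2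

/-- The squared concentration `c(t)² = e(1 + 2t)/(‖∇w‖₂² h(t))`. [cite: Nguyen2022NSGlobalNoForce, (3.0.3) p. 17] -/
def c2 (t : ℝ) : ℝ := er * (1 + 2 * t) / (zr * hh t)

/-- The concentration `c(t)`. [cite: Nguyen2022NSGlobalNoForce, (3.0.3) p. 17] -/
def cc (t : ℝ) : ℝ := Real.sqrt (c2 t)

/-- The amplitude `a(t) = (h(t) c(t)³)^{1/2}`. [cite: Nguyen2022NSGlobalNoForce, (3.0.3) p. 17] -/
def aa (t : ℝ) : ℝ := Real.sqrt (hh t * cc t ^ 3)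

/-- **The field** `u(t, x) = a(t) · w(c(t) x)`. [cite: Nguyen2022NSGlobalNoForce, Thm 3.0.1 p. 17] -/
def uu (t : ℝ) : E3 → E3 := fun x => aa t • w (cc t • x)

/-- `h > 0` on `[0, 1/2]`. [folklore] -/
theorem hh_pos {t : ℝ} (h0 : 0 ≤ t) (h1 : t ≤ 1 / 2) : 0 < hh t := by
  simp only [hh]; nlinarith

/-- `c² > 0` on `[0, 1/2]`. [folklore] -/
theorem c2_pos {t : ℝ} (h0 : 0 ≤ t) (h1 : t ≤ 1 / 2) : 0 < c2 t := by
  have := er_pos; have := zr_pos; have := hh_pos h0 h1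
  simp only [c2]; positivity

/-- `c > 0` on `[0, 1/2]`. [folklore] -/
theorem cc_pos {t : ℝ} (h0 : 0 ≤ t) (h1 : t ≤ 1 / 2) : 0 < cc t := Real.sqrt_pos.2 (c2_pos h0 h1)

/-- `c² = c2`. [folklore] -/
theorem cc_sq {t : ℝ} (h0 : 0 ≤ t) (h1 : t ≤ 1 / 2) : cc t ^ 2 = c2 t :=
  Real.sq_sqrt (c2_pos h0 h1).le

/-- `a² = h c³`. [folklore] -/
theorem aa_sq {t : ℝ} (h0 : 0 ≤ t) (h1 : t ≤ 1 / 2) : aa t ^ 2 = hh t * cc t ^ 3 :=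
  Real.sq_sqrt (mul_nonneg (hh_pos h0 h1).le (pow_nonneg (cc_pos h0 h1).le 3))

/-- **Energy of the field**: `‖u(t)‖²_{L²(ℝ³)} = e·(1 − t − t²)` on `[0, 1/2]`.
[cite: Nguyen2022NSGlobalNoForce, (3.0.4) p. 18] -/
theorem energy_uu {t : ℝ} (h0 : 0 ≤ t) (h1 : t ≤ 1 / 2) :
    energyOn univ (uu t) = ENNReal.ofReal (er * hh t) := by
  have hc := cc_pos h0 h1
  have hh0 := hh_pos h0 h1
  unfold energyOn uu
  rw [Measure.restrict_univ]
  calc ∫⁻ x, ‖aa t • w (cc t • x)‖ₑ ^ 2 = ∫⁻ x, ‖aa t‖ₑ ^ 2 * ‖w (cc t • x)‖ₑ ^ 2 := by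
        simp_rw [enorm_smul, mul_pow]
    _ = ‖aa t‖ₑ ^ 2 * ∫⁻ x, ‖w (cc t • x)‖ₑ ^ 2 :=
        lintegral_const_mul' _ _ (ENNReal.pow_ne_top enorm_ne_top)
    _ = ‖aa t‖ₑ ^ 2 * (ENNReal.ofReal |(cc t ^ 3)⁻¹| * eW) := by
        rw [lintegral_comp_smul (fun y => ‖w y‖ₑ ^ 2) hc.ne']; rfl
    _ = ENNReal.ofReal (er * hh t) := by
        rw [eW_eq, Real.enorm_eq_ofReal_abs, ← ENNReal.ofReal_pow (abs_nonneg _),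
          ← ENNReal.ofReal_mul (abs_nonneg _), ← ENNReal.ofReal_mul (by positivity)]
        congr 1
        rw [sq_abs, aa_sq h0 h1, abs_of_pos (by positivity)]
        field_simp

/-- **Enstrophy of the field**: `‖∇u(t)‖²_{L²(ℝ³)} = e·(1 + 2t)` on `[0, 1/2]`.
[cite: Nguyen2022NSGlobalNoForce, (3.0.4) p. 18] -/
theorem enstrophy_uu {t : ℝ} (h0 : 0 ≤ t) (h1 : t ≤ 1 / 2) :
    enstrophyOn univ (uu t) = ENNReal.ofReal (er * (1 + 2 * t)) := by
  have hc := cc_pos h0 h1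
  have hh0 := hh_pos h0 h1
  have hz := zr_pos
  have hfd : ∀ x, fderiv ℝ (fun y : E3 => aa t • w (cc t • y)) x =
      (aa t * cc t) • fderiv ℝ w (cc t • x) :=
    fun x => (hasFDerivAt_smul_w_smul _ _ x).fderiv
  unfold enstrophyOn uu
  rw [Measure.restrict_univ]
  simp_rw [hfd, frobeniusNormSq_smul, ENNReal.ofReal_mul (sq_nonneg _)]
  rw [lintegral_const_mul' _ _ ENNReal.ofReal_ne_top,
    lintegral_comp_smul (fun y => ENNReal.ofReal (frobeniusNormSq (fderiv ℝ w y))) hc.ne']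
  change ENNReal.ofReal ((aa t * cc t) ^ 2) * (ENNReal.ofReal |(cc t ^ 3)⁻¹| * zW) = _
  rw [zW_eq, ← ENNReal.ofReal_mul (abs_nonneg _), ← ENNReal.ofReal_mul (sq_nonneg _)]
  congr 1
  rw [mul_pow, aa_sq h0 h1, abs_of_pos (by positivity)]
  have h3 : cc t ^ 2 * (zr * hh t) = er * (1 + 2 * t) := by
    rw [cc_sq h0 h1, c2]; field_simp
  field_simp
  nlinarith [h3]

/-- The time set of (3.0.1) with `T = 1/2` is `[0, 1/2)`. [folklore] -/
theorem timeSet_eq :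
    {s : ℝ | 0 ≤ s ∧ ENNReal.ofReal s < ENNReal.ofReal (1 / 2)} = Ico (0 : ℝ) (1 / 2) := by
  ext s
  simp only [mem_setOf_eq, mem_Ico, ENNReal.ofReal_lt_ofReal_iff (by norm_num : (0 : ℝ) < 1 / 2)]

/-- `(e h)′ = −e(1 + 2t)`. [folklore] -/
theorem hasDerivAt_er_hh (t : ℝ) :
    HasDerivAt (fun s => er * hh s) (-1 * (er * (1 + 2 * t))) t := by
  have h := (((hasDerivAt_const t (1 : ℝ)).sub (hasDerivAt_id' t)).sub
    ((hasDerivAt_id' t).mul (hasDerivAt_id' t))).const_mul er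
  refine (h.congr_deriv (by ring)).congr_of_eventuallyEq (Eventually.of_forall fun s => ?_)
  simp only [hh, Pi.sub_apply, Pi.mul_apply]; ring

/-- `(e (1 + 2t))′ = 2e`. [folklore] -/
theorem hasDerivAt_er_lin (t : ℝ) : HasDerivAt (fun s => er * (1 + 2 * s)) (2 * er) t := by
  have h := (((hasDerivAt_id' t).const_mul (2 : ℝ)).const_add (1 : ℝ)).const_mul er
  exact h.congr_deriv (by ring)

/-- **The field obeys (3.0.1)** on `ℝ³ × [0, 1/2)` with `C₀ = 1`, `C₁ = 2/e²`.
[cite: Nguyen2022NSGlobalNoForce, Thm 3.0.1 eq. (3.0.1) p. 17] -/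
theorem laws_uu : Laws301 univ (ENNReal.ofReal (1 / 2)) 1 (2 / er ^ 2) uu := by
  intro t ht0 htT
  have ht1 : t < 1 / 2 := (ENNReal.ofReal_lt_ofReal_iff (by norm_num)).1 htT
  have he := er_pos
  rw [timeSet_eq]
  refine ⟨by rw [energy_uu ht0 ht1.le]; exact ENNReal.ofReal_ne_top,
    by rw [enstrophy_uu ht0 ht1.le]; exact ENNReal.ofReal_ne_top, ?_, ⟨2 * er, ?_, ?_⟩⟩
  · rw [enstrophy_uu ht0 ht1.le, ENNReal.toReal_ofReal (by positivity)]
    refine (hasDerivAt_er_hh t).hasDerivWithinAt.congr_of_mem (fun s hs => ?_) ⟨ht0, ht1⟩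
    rw [energy_uu hs.1 hs.2.le,
      ENNReal.toReal_ofReal (mul_nonneg he.le (hh_pos hs.1 hs.2.le).le)]
  · refine (hasDerivAt_er_lin t).hasDerivWithinAt.congr_of_mem (fun s hs => ?_) ⟨ht0, ht1⟩
    rw [enstrophy_uu hs.1 hs.2.le, ENNReal.toReal_ofReal (by nlinarith [hs.1])]
  · rw [enstrophy_uu ht0 ht1.le, ENNReal.toReal_ofReal (by positivity)]
    have h1 : (1 : ℝ) ≤ (1 + 2 * t) ^ 3 := one_le_pow₀ (by linarith)
    rw [show 2 / er ^ 2 * (er * (1 + 2 * t)) ^ 3 = 2 * er * (1 + 2 * t) ^ 3 by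
      field_simp]
    nlinarith [h1]

/-- **(3.0.2) fails for the field**: `E + Z = e(2 + t − t²)` is larger at `t = 1/4` than at `t = 0`.
[cite: Nguyen2022NSGlobalNoForce, Thm 3.0.1 eq. (3.0.2) p. 17] -/
theorem not_monotone_uu : ¬ Monotone302 univ (ENNReal.ofReal (1 / 2)) uu := by
  intro hA
  unfold Monotone302 at hA
  rw [timeSet_eq] at hA
  have key := hA (show (0 : ℝ) ∈ Ico (0 : ℝ) (1 / 2) by norm_num)
    (show (1 / 4 : ℝ) ∈ Ico (0 : ℝ) (1 / 2) by norm_num) (by norm_num)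
  have he := er_pos
  have hq : 0 < hh (1 / 4) := hh_pos (by norm_num) (by norm_num)
  have hz : 0 < hh 0 := hh_pos le_rfl (by norm_num)
  beta_reduce at key
  rw [energy_uu le_rfl (by norm_num), enstrophy_uu le_rfl (by norm_num),
    energy_uu (by norm_num) (by norm_num), enstrophy_uu (by norm_num) (by norm_num),
    ← ENNReal.ofReal_add (by positivity) (by positivity),
    ← ENNReal.ofReal_add (by positivity) (by positivity),
    ENNReal.ofReal_le_ofReal_iff (by positivity)] at key
  simp only [hh] at key
  nlinarith

/-- **THEOREM 3.0.1 (p. 17), as printed, is false**: the laws (3.0.1) do not force (3.0.2).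
Witness `Ω = ℝ³`, `T = 1/2`, `C₀ = 1`, `C₁ = 2/e²`, `u(t,x) = a(t) w(c(t) x)`.
[cite: Nguyen2022NSGlobalNoForce, Thm 3.0.1 p. 17] -/
theorem not_Step5_Theorem301 : ¬ Step5_Theorem301 := fun h =>
  not_monotone_uu (h univ isOpen_univ isConnected_univ _ (ENNReal.ofReal_pos.2 (by norm_num))
    1 (2 / er ^ 2) one_pos (by have := er_pos; positivity) uu laws_uu)

end Summit.NavierStokesRegularity.NavierStokesRegularity.Theorems.Nguyen2022

end
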